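import Literature.MathematicalPhysics.QuantumFieldTheory.Balaban1983to89.B8CubeMemberZd
import Literature.MathematicalPhysics.QuantumFieldTheory.Balaban1983to89.B8LeafModelZdOfHFP

/-!
# `Balaban1983to89.B8Prop6CubeMember` — [Balaban1985RegularSpaces] **PROPOSITION 6** (p. 99) AT THE CONCRETE CUBE MEMBER of the N05
# index: «If 7dL²Mα₀ ≤ c₁, then the assumptions of Theorem 4 are satisfied for the pair of configurations 1, U₀″, thus there exists a
# gauge transformation u such that U₁ = U₀″^{u⁻¹} satisfies …» — DERIVED IN THE KERNEL from the concrete Theorem-4 driver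
# `B8Thm4Concrete.thm4Body_concrete_uniform` (background `U₀ := 1`, perturbation `U′ := U₀″ = B8Ineq133.cutFixed …`, domains
# `Ω_j := □_j`, restriction sites := print's truncations `B8CubeMemberZd.cubeLamS`), MODULO THE DRIVER'S FOUR SOCKETS AT THAT MEMBER
# (Prop. 5 ∃ base ∕ ∃ step, [4] Thm 3.3, Prop. 5 uniqueness — `B8LeafModelZd.SockP5base`∕`SockP5`∕`SockH59`∕`SockP5u`)

statement-level skeleton of published theorems with citation tags; proofs where landed; nothing here is a claim about the
Yang–Mills mass gap

T. Bałaban, *Spaces of regular gauge field configurations on a lattice and gauge fixing conditions*, Commun. Math. Phys. **99**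
(1985) 75–102 `[Balaban1985RegularSpaces]` ("B8"), Sect. F pp. 98–99, Theorem 4 p. 88.  PDF held:
`paper:balaban1985-cmp99-regular-spaces-gauge-fixing` (journal page = PDF page + 74).

CITATION HEADER (lean-in-tree rule).  Cell `pub-ymgap` (YM Track A, HUMAN RULING D-0062), DAG node N05 = [B8], seat `pub-ymgap-dag-n05-c`
(R134 fan-out; FAN-OUT v1.1 §N05 row s3b, kernel half, module 2; desk note `HOME/pub-ymgap-dag-n05-a/S3B-PROP6-DESIGN-g6.md`).  WHAT IS
REPRODUCED: the p. 99 paragraph between (1.133) and Proposition 6 and the existence∕uniqueness∕(1.135) content of Proposition 6, with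
Theorem 4 supplied NOT as an abstract interface (`B8Prop6OfThm4.Thm4AtOne`, «never instantiated») but by the tree's concrete Theorem-4
driver on the `ℤᵈ` carriers; (1.132)∕(1.133) by `B8Eq131Cubes.ineq132_cubes` and `B8Ineq133.ineq133`; the cube member by
`B8CubeMemberZd`.  Kind «kernel-checked proof», theorems only, no `def`, no `… : Prop` fact.

WHAT IS PRINTED (p. 99 [PDF 25], verbatim): *"and let us define a configuration U₀″ as equal to U₀′ on □̃, and equal to 1 outside □̃. It
satisfies the conditions U₀″ ∈ 𝔄_k({□_j}, L³α₀) ∩ Ax_k(ℭ_k, 1), (1.132)  |Ū₀″ʲ − 1| < 6dL²Mα₀ on □_j^{(j)}, j = 0, 1, …, k, (1.133) by the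
construction of U₀″, and the inequality (1.130). If 7dL²Mα₀ ≤ c₁, then the assumptions of Theorem 4 are satisfied for the pair of
configurations 1, U₀″, thus there exists a gauge transformation u such that U₁ = U₀″^{u⁻¹} satisfies the conditions (1.36)–(1.39).
Especially we have for M = R₁M₁, U₁ = e^{iηA}, |A|, |∇^ηA| < 7dL²B₁R₁M₁α₀ on □. (1.134) … **Proposition 6.** Let U₀, U₀′, □, □̃ be as
described above, and let 7dL²Mα₀ ≤ c₁. There exists a gauge transformation u defined on □̃ and such, that U₀^{u⁻¹} = U₁ = e^{iηA} on □̃,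
(1.135)  Lʲη|A|, (Lʲη)²|∇^ηA|, (Lʲη)³|∂^{η*}∂^ηA|, (Lʲη)³|Δ^ηA| < 7dL²B₁Mα₀ on □_j, (1.136) … R∂^{η*}A = 0, the operator R is determined
by {□_j}. (1.138)"*.

WHAT THIS MODULE PROVES (kernel, 0 sorry; `𝔸` a non-trivial C⋆-algebra, gauge group = its unitary group `unitaryUnits 𝔸`, as in the
whole N05 lineage; `a`∕`M` = lower corner∕side of `□^{(k)}`, `ρ = R₁M₁`).
§1 `norm_cutFixed_sub_one_le` — `U₀″` IS WITHIN `6dL²Mα₀` OF `1` ON EVERY FINE BOND (inside `□̃` by (1.133) at `j = 0` read on the whole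
   tower box, `B8Ineq133.ineq133`; outside `□̃` because `U₀″ = 1` there): the driver's level-0 collar clause of (1.66) for the pair
   `1, U₀″` (the located mismatch of the desk note — NOT available from the `Cond166`-shape of (1.133) alone).
§2 **`thm4_hypotheses_one_cutFixed`** — «THE ASSUMPTIONS OF THEOREM 4 ARE SATISFIED FOR THE PAIR 1, U₀″» in the currency of the concrete
   driver at the cube member: `U₀″` unitary-valued; (1.33) `1 ∈ 𝔄_k({□_j}, L³α₀)`; (1.34) `U₀″ ∈ 𝔄_k({□_j}, L³α₀)` and `Ax` at EVERY
   truncation level (`B8CubeMemberZd.inAx_cubeLamS_of_inAxOne`); (1.66) in the box form at every level (`h135_of_cond166_one`) and on the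
   level-0 collar (§1) — with `(α₀, α₁) ↦ (L³α₀, 6dL²Mα₀)`.
§3 **`prop6_exists_cubeMember`** — PROPOSITION 6 AT THE MEMBER, MODULO THE FOUR SOCKETS: ONE threshold `c₁(d, L, B₀, B₀′, cu, cP) > 0` (the
   driver's) such that for every cube datum `(η, k ≥ 1, a, M, ρ)` with `L ≤ ρ ≤ M`, `11d < M`, every unitary-valued `U₀ ∈ 𝔄_k({Ω_j}, α₀)`
   with `□̃ ⊂ Ω_{k−1}` in the regime of (1.130), and `L³α₀ + 6dL²Mα₀ ≤ c₁`: there is a unitary gauge transformation `u`, `= 1` off `□₀`,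
   with (1.29) w.r.t. the cube member's restriction sets, such that `U₁ = U₀″^{u⁻¹}` is in the Landau gauge of record (1.38)
   (`IsLandau138W`) and has the (1.62)∕(1.36)₁-shape `U₁ = e^{iηA}`, `A` Hermitian, `|A| ≤ 5dLB₀(L³α₀ + 6dL²Mα₀)(Lʲη)⁻¹` on the bonds of the
   plaquettes touching `□_j`, `j ≤ k`; `u` is UNIQUE among such; and (1.135) `U₀^{w⁻¹} = U₁` on `□̃` with the unitary `w := v⁻¹u`, `v` the
   gauge transformation `U₀ ↦ U₀′` of p. 98 (`B8Prop6OfThm4.agree135`).  `prop6_exists_cubeMember_printed`: the same under print's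
   «7dL²Mα₀ ≤ c₁» and the implicit `L ≤ dM`, with the printed constant `7dL²B₁Mα₀`, `B₁ = 5dLB₀` (`B8Prop6OfThm4.smallness_134`∕`const_136`).

VERSION v1.1 (same seat, APPEND-ONLY §4; + import `B8LeafModelZdOfHFP`): `prop6_exists_cubeMember_of_HFP₄` — §3 with the two Prop.-5 existence
sockets in the PLAIN FIXED-POINT currency `SockHFP₀`∕`SockHFP` of the knit and four independent provider thresholds (the adapters
`sockP5base_of_sockHFP₀`∕`sockP5_of_sockHFP`∕`windows4`, as in `B8LeafModelZd3.thm4Printed_zd3_of_HFP₄`); **`prop6_asPrinted_cubeMember_of_HFP₄`**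
— PROPOSITION 6 AT THE MEMBER WITH EXACTLY PRINT'S HYPOTHESES: `U₀ ∈ 𝔄_k({Ω_j}, α₀)`, `□̃ ⊂ Ω_{k−1}` (p. 98), «7dL²Mα₀ ≤ c₁», the implicit
`L ≤ dM` and the (1.130)-side condition `11d < M` (G-B8-14); the tree's regime conditions of (1.130) (`C0·α₀L² ≤ 1∕3`, `2α₀L² ≤ c₂′`,
`11d²L²α₀ + (M + 4ρ)dL²α₀ ≤ 1∕6`) are ABSORBED into the threshold (`c₁ ≤ 7∕(3C0)`, `c₁ ≤ 7c₂′∕2`, `c₁ ≤ 7∕36`; `regime_of_printed_smallness`);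
the closing `end`s of the sections are supplied.  §§1–3 unchanged.

HONEST SCOPE.  (i) MODULO the four sockets AT THIS MEMBER — Prop. 5's fixed point (base∕step), the in-edge b9 ([4] Thm 3.3 in Prop. 3's
frame) and Prop. 5's uniqueness (1.109), all at the FLAT background `U₀ = 1` on the cube family; they are displayed hypotheses, not
discharged here (their letters at `U₀ = 1` are the flat operators of [B5]∕[4]; cf. `B8Ineq192MultiLevelBox`, `B8Ineq198MultiLevelBox` on
Neumann boxes).  (ii) Of (1.136) only the `|A|` member ((1.62)) is concluded; the `∇`, `∂*∂`, `Δ` members are Proposition 3's at the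
member (`B8LeafModelZd3.prop3Printed_zd3` at `U₀ := 1`, a further socket) and (1.137)'s identity lives with the driver's (1.37) — not
restated; (1.137)'s inequality is `B8Prop6OfThm4.ineq137_cube` (landed).  (iii) «`u` defined on `□̃`» is read as «`u` unitary on `ℤᵈ`,
`= 1` off `□₀ ⊂ □̃`» (the driver's gauge group is carried by `Ω₀`); with `B8CubeMemberZd.restr_cubeLamS_iff` this is (1.29) w.r.t. print's
`ℭ_k`.  (iv) `≤` where print has `<` in (1.62); `ℤᵈ` carriers.  Count-neutral; N05 NOT discharged; nothing continuum ∕ ℝ⁴ ∕ OS ∕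
mass-gap ∕ Clay.  Unit `pub-ymgap-dag-n05-c` (g0), 2026-08-26.

SCOPE NOTE (v-scope, 2026-08-27, seat pub-ymgap-dag-n05-c g11; director-ym LINE №196; NO statement change).  Every hypothesis of this file that is a
(1.59)-type socket read over the typed constraint-bond class `B8CubeMemberZd.cubeLamB` ∕ `B8IdxB8LawsB.towerBonds` (`SockH59`-, `SockB9P3`-shaped
binders: Theorem 4's ∕ Proposition 3's frame) is UNINHABITED at every nested member with `k ≥ 1` as soon as the socket is owed at the flat background
`U₀ = 1` (interior shell gauge modes — kernel certificates `B8Ineq159FlatShellModeVacuity` p572834, `B8SockB9P3ShellModeVacuityUniv` p576185; root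
cause: the class has no crossing bond, `B8Ineq159FlatCubeMemberPrinted.towerBonds_inner_of_printTower`).  The theorems below stay TRUE (PASS-AS-DECLARED) and
are VACUOUS wherever such a socket is among their hypotheses; the repaired class is `B8Ineq159FlatCubeMemberPrinted.cubeLamBP` (print's (1.31)∕[B6] (2.3)),
over which the consumers are being re-typed (edition γ).  Sockets over the SITE tower `cubeLamS` only (`SockHFP`, `SockP5u…`, the REAL families, the
𝒢-bound) are NOT affected.

-/

noncomputable section

namespace Literature.MathematicalPhysics.QuantumFieldTheory.Balaban1983to89.B8Prop6CubeMember

open B7Prop1Explicit B7Prop2Explicit B7Prop1Local B7Eq92Concrete B8Ineq130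
open B7Prop2Explicit (C0 c2')
open B8Ineq132 (InAk InAxOne avgIter_one pdevOn_lt_of_inAk)
open B8Ineq133 (cutFixed ineq133)
open B8Eq115GaugeFixing (localGauge gaugeAct_mem_of)
open B8Eq119TwistedAxial (InAx Restr129)
open B8Eq184Proof (cfgExp)
open B8Lemma1NonAbelian (mulCfg)
open B8Eq140Level (SideTouches)
open B8Eq138LandauZd (IsLandau138W logCfg)
open B8Eq131Cubes (cube tcube tLo tHi ctr LamP ctr_mem two_crad_le tLo_le_tHi ineq132_cubes)
open B8Eq131CubesAdmissible (cubeFam cubeFam_false_of_le inAk_cubeFam_iff)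
open B8LeafModelZd (SockP5base SockP5 SockH59 SockP5u)
open B8LeafModelZdOfHFP (SockHFP₀ SockHFP sockP5base_of_sockHFP₀ sockP5_of_sockHFP sockH59_anti sockP5u_anti sockHFP₀_anti sockHFP_anti
  windows4)
open B8Prop6OfThm4 (Cond166 cond166_one_iff one_inAk localGauge_mem agree135 smallness_134 const_136)
open B8CubeMemberZd (cubeLamS cubeLamB hΩ_cubeFam hbox_cubeLamB hclass_cubeLamB htower_cubeLam hpart_cubeLam
  inAx_cubeLamS_of_inAxOne h135_of_cond166_one)

export B7Prop1Explicit (Site)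

variable {d : ℕ}

/-! ## §1 The level-0 collar clause of (1.66) for `U₀″`: `|U₀″_b − 1| ≤ 6dL²Mα₀` on EVERY fine bond -/

section Collar

variable {𝔸 : Type*} [NormedRing 𝔸] [NormOneClass 𝔸] [NormedAlgebra ℂ 𝔸] [CompleteSpace 𝔸]

/-- **`U₀″` is within `6dL²Mα₀` of `1` on every bond of the fine lattice**: inside the tower box `□̃` this is (1.133) at `j = 0` read on
the whole of `□̃` («by the construction of U₀″, and the inequality (1.130)», `B8Ineq133.ineq133`, last clause at depth `k`); outside, `U₀″ = 1`
(«equal to 1 outside □̃»).  Setting as in `B8Eq131Cubes.ineq132_cubes`.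
[cite: Balaban1985RegularSpaces, (1.133) p.99, p.99 («equal to U₀′ on □̃, and equal to 1 outside □̃»), (1.130) p.98] -/
theorem norm_cutFixed_sub_one_le (L : ℕ) (hL : 2 ≤ L) (hd : 1 ≤ d) {G : Subgroup 𝔸ˣ} (hG : AvgClosed d L G) (k : ℕ)
    (U : Site d → Fin d → 𝔸ˣ) (hU : ∀ x κ, U x κ ∈ G) {α₀ : ℝ} (hα : 0 < α₀)
    (hα3 : C0 d * (α₀ * (L : ℝ) ^ 2) ≤ 1 / 3) (hα2 : 2 * (α₀ * (L : ℝ) ^ 2) ≤ c2' d L)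
    (a : Site d) {M ρ : ℕ} (hρ : 1 ≤ ρ) (hρM : ρ ≤ M) (hM : 11 * (d : ℝ) < M)
    {η : ℝ} {Ω : ℕ → Set (Site d)} (hA : InAk L k η α₀ Ω U) (hT : tcube L a M ρ k ⊆ Ω (k - 1))
    (hsmall : 11 * (d : ℝ) ^ 2 * (L : ℝ) ^ 2 * α₀ + ((M : ℝ) + 4 * ρ) * d * (L : ℝ) ^ 2 * α₀ ≤ 1 / 6) (x : Site d) (ν : Fin d) :
    ‖((cutFixed L (tLo a ρ) (tHi a M ρ) U k (ctr a M) x ν : 𝔸ˣ) : 𝔸) - 1‖ ≤ 6 * d * (L : ℝ) ^ 2 * M * α₀ := by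
  have hL1 : 1 ≤ L := le_trans (by norm_num) hL
  have hM1 : 1 ≤ M := hρ.trans hρM
  obtain ⟨hy, hy', hrad⟩ := ctr_mem (a := a) (ρ := ρ) hM1
  have hRM : (ρ : ℝ) * 1 ≤ (M : ℝ) := by rw [mul_one]; exact_mod_cast hρM
  have hsmall' : 11 * (d : ℝ) ^ 2 * (L : ℝ) ^ 2 * α₀ + ((M : ℝ) + 4 * ρ * 1) * d * (L : ℝ) ^ 2 * α₀ ≤ 1 / 6 := by
    rwa [mul_one]
  have hΩ : ∃ l, l ≤ k ∧ k ≤ l + 1 ∧ ∀ x, InBox (tlo L (tLo a ρ) k) (thi L (tHi a M ρ) k) x → x ∈ Ω l :=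
    ⟨k - 1, Nat.sub_le _ _, by omega, fun x hx => hT hx⟩
  have h17 := pdevOn_lt_of_inAk hL1 hα hA hΩ
  obtain ⟨-, hone, -, -, -, h6⟩ := ineq133 L hL hd hG k U hU hα hα3 hα2 (tLo a ρ) (tHi a M ρ) (tLo_le_tHi hM1) h17 hy hy'
    hrad (two_crad_le M ρ) hRM hM hsmall'
  have hbd0 : 0 ≤ 6 * d * (L : ℝ) ^ 2 * M * α₀ := by positivity
  by_cases hin : InBox (tlo L (tLo a ρ) k) (thi L (tHi a M ρ) k) x ∧ InBox (tlo L (tLo a ρ) k) (thi L (tHi a M ρ) k) (x + e ν)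
  · have h := h6 k le_rfl x ν (fun i => (hin.1 i).1) (fun i => (hin.2 i).2)
    rw [Nat.sub_self, avgIter_zero] at h
    exact h.le
  · rw [hone x ν hin, Units.val_one, sub_self, norm_zero]
    exact hbd0

end Collar

/-! ## §2 «The assumptions of Theorem 4 are satisfied for the pair of configurations 1, U₀″» — in the driver's currency -/

section Hypotheses

variable {𝔸 : Type*} [CStarAlgebra 𝔸] [Nontrivial 𝔸]

/-- **THE p. 99 SENTENCE, at the cube member, in the currency of `B8Thm4Concrete.thm4Body_concrete_uniform`** (background `1`,
perturbation `U₀″`, `(α₀, α₁) ↦ (L³α₀, 6dL²Mα₀)`): `U₀″` is unitary-valued; (1.33) for `1`; (1.34) = (1.132) — `U₀″ ∈ 𝔄_k({□_j}, L³α₀)` and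
`Ax` at every truncation level `m ≤ k` w.r.t. `cubeLamS … m` (from `Ax_k(ℭ_k, 1)`); (1.66) = (1.133) in the box form at every level-`j` bond
whose box lies in `□_j`, and on the level-0 collar (§1). [cite: Balaban1985RegularSpaces, p.99 (sentence after (1.133)), (1.132)–(1.133) p.99, (1.33)–(1.34) p.82, (1.66) p.87] -/
theorem thm4_hypotheses_one_cutFixed (L : ℕ) (hL : 2 ≤ L) (hd : 1 ≤ d) (k : ℕ)
    (U : Site d → Fin d → 𝔸ˣ) (hU : ∀ x κ, U x κ ∈ unitaryUnits 𝔸) {α₀ : ℝ} (hα : 0 < α₀)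
    (hα3 : C0 d * (α₀ * (L : ℝ) ^ 2) ≤ 1 / 3) (hα2 : 2 * (α₀ * (L : ℝ) ^ 2) ≤ c2' d L)
    (a : Site d) {M ρ : ℕ} (hρ : 1 ≤ ρ) (hρM : ρ ≤ M) (hM : 11 * (d : ℝ) < M)
    {η : ℝ} (hη : 0 < η) {Ω : ℕ → Set (Site d)} (hA : InAk L k η α₀ Ω U) (hT : tcube L a M ρ k ⊆ Ω (k - 1))
    (hsmall : 11 * (d : ℝ) ^ 2 * (L : ℝ) ^ 2 * α₀ + ((M : ℝ) + 4 * ρ) * d * (L : ℝ) ^ 2 * α₀ ≤ 1 / 6) :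
    (∀ x κ, cutFixed L (tLo a ρ) (tHi a M ρ) U k (ctr a M) x κ ∈ unitaryUnits 𝔸) ∧
    InAk L k η ((L : ℝ) ^ 3 * α₀) (cubeFam false L a M ρ k) (1 : Site d → Fin d → 𝔸ˣ) ∧
    InAk L k η ((L : ℝ) ^ 3 * α₀) (cubeFam false L a M ρ k)
      (mulCfg (cutFixed L (tLo a ρ) (tHi a M ρ) U k (ctr a M)) (1 : Site d → Fin d → 𝔸ˣ)) ∧
    (∀ m, m ≤ k → InAx L m (cubeLamS L a M ρ k m) (1 : Site d → Fin d → 𝔸ˣ)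
      (mulCfg (cutFixed L (tLo a ρ) (tHi a M ρ) U k (ctr a M)) (1 : Site d → Fin d → 𝔸ˣ))) ∧
    (∀ j, j ≤ k → ∀ (z : Site d) (μ : Fin d),
      (∀ x, InBox (loK L j z) (bondHiK L j z μ) x → x ∈ cubeFam false L a M ρ k j) →
        ‖(avgIter L (mulCfg (cutFixed L (tLo a ρ) (tHi a M ρ) U k (ctr a M)) (1 : Site d → Fin d → 𝔸ˣ)) j z μ : 𝔸) -
            (avgIter L (1 : Site d → Fin d → 𝔸ˣ) j z μ : 𝔸)‖ ≤ 6 * d * (L : ℝ) ^ 2 * M * α₀) ∧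
    (∀ b ∈ {b : Site d × Fin d | SideTouches (cubeFam false L a M ρ k 0) b.1 b.2},
      ‖((cutFixed L (tLo a ρ) (tHi a M ρ) U k (ctr a M) b.1 b.2 : 𝔸ˣ) : 𝔸) - 1‖ ≤ 6 * d * (L : ℝ) ^ 2 * M * α₀) := by
  have hL1 : 1 ≤ L := le_trans (by norm_num) hL
  have hG := avgClosed_unitaryUnits (𝔸 := 𝔸) d L
  have hLpos : (0 : ℝ) < L := by exact_mod_cast lt_of_lt_of_le (by norm_num) hL
  have hα₀' : 0 < (L : ℝ) ^ 3 * α₀ := by positivity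
  obtain ⟨h132a, h132b, h133⟩ := ineq132_cubes L hL hd hG k U hU hα hα3 hα2 a hρ hρM hM hη hA hT hsmall
  have hmem : ∀ x κ, cutFixed L (tLo a ρ) (tHi a M ρ) U k (ctr a M) x κ ∈ unitaryUnits 𝔸 := by
    have hM1 : 1 ≤ M := hρ.trans hρM
    have hΩ : ∃ l, l ≤ k ∧ k ≤ l + 1 ∧ ∀ x, InBox (tlo L (tLo a ρ) k) (thi L (tHi a M ρ) k) x → x ∈ Ω l :=
      ⟨k - 1, Nat.sub_le _ _, by omega, fun x hx => hT hx⟩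
    have hvG : ∀ x, localGauge L (tLo a ρ) (tHi a M ρ) U k (ctr a M) x ∈ unitaryUnits 𝔸 :=
      localGauge_mem L hL hG k U hU hα hα3 hα2 (tLo_le_tHi hM1) (pdevOn_lt_of_inAk hL1 hα hA hΩ) (ctr a M)
    exact B8Ineq133.cutCfg_mem (gaugeAct_mem_of hU hvG)
  have hW : mulCfg (cutFixed L (tLo a ρ) (tHi a M ρ) U k (ctr a M)) (1 : Site d → Fin d → 𝔸ˣ) =
      cutFixed L (tLo a ρ) (tHi a M ρ) U k (ctr a M) := by
    rw [show mulCfg (cutFixed L (tLo a ρ) (tHi a M ρ) U k (ctr a M)) (1 : Site d → Fin d → 𝔸ˣ) =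
      cutFixed L (tLo a ρ) (tHi a M ρ) U k (ctr a M) * 1 from rfl, mul_one]
  have h166 : Cond166 L k a M ρ (1 : Site d → Fin d → 𝔸ˣ) (cutFixed L (tLo a ρ) (tHi a M ρ) U k (ctr a M))
      (6 * d * (L : ℝ) ^ 2 * M * α₀) := (cond166_one_iff L k a M ρ _ _).2 h133
  refine ⟨hmem, one_inAk hL1 k hη hα₀' _, ?_, ?_, h135_of_cond166_one hL1 a M ρ k h166, fun b _ => ?_⟩
  · rw [hW]; exact (inAk_cubeFam_iff L k η _ a M ρ _).2 h132a
  · intro m hm; rw [hW]; exact inAx_cubeLamS_of_inAxOne hL1 a M ρ k h132b m hm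
  · exact norm_cutFixed_sub_one_le L hL hd hG k U hU hα hα3 hα2 a hρ hρM hM hA hT hsmall b.1 b.2

end Hypotheses

/-! ## §3 PROPOSITION 6 at the cube member, modulo the driver's four sockets -/

section Prop6

variable {𝔸 : Type} [CStarAlgebra 𝔸] [Nontrivial 𝔸]

/-- **PROPOSITION 6 (p. 99) AT THE CONCRETE CUBE MEMBER, MODULO THE FOUR SOCKETS** («the assumptions of Theorem 4 are satisfied for the
pair of configurations 1, U₀″, thus there exists a gauge transformation u such that U₁ = U₀″^{u⁻¹} satisfies the conditions …»; Theorem 4 =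
the tree's concrete driver `B8Thm4Concrete.thm4Body_concrete_uniform` at `U₀ := 1`, `U′ := U₀″`, `Ω_j := □_j`, `Λs := cubeLamS`,
`Λb := cubeLamB`).  ONE threshold `c₁ > 0` (on `d, L, B₀, B₀′, cu, cP`); for every cube datum `(η > 0, k ≥ 1, a, L ≤ ρ ≤ M, 11d < M)` at
which the four sockets hold, every unitary-valued `U₀ ∈ 𝔄_k({Ω_j}, α₀)` with `□̃ ⊂ Ω_{k−1}` in the regime of (1.130), and
`L³α₀ + 6dL²Mα₀ ≤ c₁`: THERE IS a unitary `u`, `= 1` off `□₀`, with (1.29) w.r.t. `cubeLamS … k`, such that `U₁ := U₀″^{u⁻¹}` satisfies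
(1.38) of record (`IsLandau138W`) and (1.62): `U₁ = e^{iηA}` with `A` Hermitian and `|A_b| ≤ 5dLB₀(L³α₀ + 6dL²Mα₀)(Lʲη)⁻¹` on the bonds of the
plaquettes touching `□_j` (`j ≤ k`); `u` is UNIQUE among the unitary, `□₀`-supported, restricted `u′` putting `U₀″` in the Landau gauge
with an exponent of that size; and (1.135): `w := v⁻¹u` is unitary and `U₀^{w⁻¹} = U₁` on the bonds of `□̃`, `v` = the gauge transformation
`U₀ ↦ U₀′` of p. 98 (`B8Eq115GaugeFixing.localGauge`). [cite: Balaban1985RegularSpaces, Prop. 6 (1.135)–(1.136) p.99, p.99 (sentence after (1.133)), Thm 4 p.88, (1.29) p.81, (1.38) p.82, (1.62) p.87] -/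
theorem prop6_exists_cubeMember (hd2 : 2 ≤ d) {L : ℕ} (hL : 2 ≤ L) {B₀ B₀' cu cP : ℝ} (hB₀ : 0 < B₀) (hB₀' : 0 < B₀')
    (hB : 2 ≤ 5 * (d : ℝ) * L * B₀) (hcu : 0 < cu) (hcP : 0 < cP) :
    ∃ c₁ : ℝ, 0 < c₁ ∧ ∀ (η : ℝ), 0 < η → ∀ (k : ℕ), 1 ≤ k → ∀ (a : Site d) (M ρ : ℕ), L ≤ ρ → ρ ≤ M → 11 * (d : ℝ) < M →
      SockP5base (𝔸 := 𝔸) L B₀ B₀' cP η k (cubeFam false L a M ρ k) (cubeLamS L a M ρ k) →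
      SockP5 (𝔸 := 𝔸) L B₀ B₀' cP η k (cubeFam false L a M ρ k) (cubeLamS L a M ρ k) →
      SockH59 (𝔸 := 𝔸) L B₀ B₀' cP η k (cubeFam false L a M ρ k) (cubeLamS L a M ρ k) (cubeLamB L a M ρ k) →
      SockP5u (𝔸 := 𝔸) L cP cu η k (cubeFam false L a M ρ k) (cubeLamS L a M ρ k) →
      ∀ (U₀ : Site d → Fin d → 𝔸ˣ), (∀ x κ, U₀ x κ ∈ unitaryUnits 𝔸) → ∀ (α₀ : ℝ), 0 < α₀ →
      C0 d * (α₀ * (L : ℝ) ^ 2) ≤ 1 / 3 → 2 * (α₀ * (L : ℝ) ^ 2) ≤ c2' d L →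
      ∀ (Ω : ℕ → Set (Site d)), InAk L k η α₀ Ω U₀ → tcube L a M ρ k ⊆ Ω (k - 1) →
      11 * (d : ℝ) ^ 2 * (L : ℝ) ^ 2 * α₀ + ((M : ℝ) + 4 * ρ) * d * (L : ℝ) ^ 2 * α₀ ≤ 1 / 6 →
      (L : ℝ) ^ 3 * α₀ + 6 * d * (L : ℝ) ^ 2 * M * α₀ ≤ c₁ →
      ∃ u : Site d → 𝔸ˣ, (∀ x, u x ∈ unitaryUnits 𝔸) ∧ (∀ x, x ∉ cubeFam false L a M ρ k 0 → u x = 1) ∧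
        Restr129 L k (cubeLamS L a M ρ k k) (1 : Site d → Fin d → 𝔸ˣ) u ∧
        IsLandau138W L k η (cubeFam false L a M ρ k 0) (cubeLamS L a M ρ k k) (1 : Site d → Fin d → 𝔸ˣ)
          (gaugeAct u⁻¹ (cutFixed L (tLo a ρ) (tHi a M ρ) U₀ k (ctr a M))) ∧
        (∀ j, j ≤ k → ∀ b ∈ {b : Site d × Fin d | SideTouches (cubeFam false L a M ρ k j) b.1 b.2},
          gaugeAct u⁻¹ (cutFixed L (tLo a ρ) (tHi a M ρ) U₀ k (ctr a M)) b.1 b.2 =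
              cfgExp η (logCfg η (gaugeAct u⁻¹ (cutFixed L (tLo a ρ) (tHi a M ρ) U₀ k (ctr a M)))) b.1 b.2 ∧
            IsSelfAdjoint (logCfg η (gaugeAct u⁻¹ (cutFixed L (tLo a ρ) (tHi a M ρ) U₀ k (ctr a M))) b.1 b.2) ∧
            ‖logCfg η (gaugeAct u⁻¹ (cutFixed L (tLo a ρ) (tHi a M ρ) U₀ k (ctr a M))) b.1 b.2‖ ≤
              (5 * (d : ℝ) * L * B₀ * ((L : ℝ) ^ 3 * α₀ + 6 * d * (L : ℝ) ^ 2 * M * α₀)) * ((L : ℝ) ^ j * η)⁻¹) ∧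
        (∀ u' : Site d → 𝔸ˣ, (∀ x, u' x ∈ unitaryUnits 𝔸) → (∀ x, x ∉ cubeFam false L a M ρ k 0 → u' x = 1) →
          Restr129 L k (cubeLamS L a M ρ k k) (1 : Site d → Fin d → 𝔸ˣ) u' →
          IsLandau138W L k η (cubeFam false L a M ρ k 0) (cubeLamS L a M ρ k k) (1 : Site d → Fin d → 𝔸ˣ)
            (gaugeAct u'⁻¹ (cutFixed L (tLo a ρ) (tHi a M ρ) U₀ k (ctr a M))) →
          (∃ A' : Site d → Fin d → 𝔸, ∀ j, j ≤ k → ∀ (x : Site d) (κ : Fin d), SideTouches (cubeFam false L a M ρ k j) x κ →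
            gaugeAct u'⁻¹ (cutFixed L (tLo a ρ) (tHi a M ρ) U₀ k (ctr a M)) x κ = cfgExp η A' x κ ∧
              ‖A' x κ‖ ≤ (5 * (d : ℝ) * L * B₀ * ((L : ℝ) ^ 3 * α₀ + 6 * d * (L : ℝ) ^ 2 * M * α₀)) * ((L : ℝ) ^ j * η)⁻¹) →
          u' = u) ∧
        (∀ x, ((localGauge L (tLo a ρ) (tHi a M ρ) U₀ k (ctr a M))⁻¹ * u) x ∈ unitaryUnits 𝔸) ∧
        AgreeOn (tlo L (tLo a ρ) k) (thi L (tHi a M ρ) k)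
          (gaugeAct ((localGauge L (tLo a ρ) (tHi a M ρ) U₀ k (ctr a M))⁻¹ * u)⁻¹ U₀)
          (gaugeAct u⁻¹ (cutFixed L (tLo a ρ) (tHi a M ρ) U₀ k (ctr a M))) := by
  have hL1 : 1 ≤ L := le_trans (by norm_num) hL
  have hd1 : 1 ≤ d := le_trans (by norm_num) hd2
  have hLpos : (0 : ℝ) < L := by exact_mod_cast lt_of_lt_of_le (by norm_num) hL
  have hdpos : (0 : ℝ) < d := by exact_mod_cast hd1
  obtain ⟨c₁, hc₁, H⟩ := B8Thm4Concrete.thm4Body_concrete_uniform (𝔸 := 𝔸) hd2 hL hB₀ hB₀' hB hcu hcP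
  refine ⟨c₁, hc₁, ?_⟩
  intro η hη k hk a M ρ hρL hρM hM SP5base SP5 SH59 SP5u U₀ hU₀ α₀ hα hα3 hα2 Ω hA hT hsmall hc
  have hρ : 1 ≤ ρ := hL1.trans hρL
  have hM1 : 1 ≤ M := hρ.trans hρM
  have hMpos : (0 : ℝ) < M := by exact_mod_cast hM1
  have hα₀' : 0 < (L : ℝ) ^ 3 * α₀ := by positivity
  have hα₁' : 0 < 6 * (d : ℝ) * (L : ℝ) ^ 2 * M * α₀ := by positivity
  obtain ⟨hmem, h33, h34, hAx, h135, h66⟩ :=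
    thm4_hypotheses_one_cutFixed L hL hd1 k U₀ hU₀ hα hα3 hα2 a hρ hρM hM hη hA hT hsmall
  have hone : ∀ x κ, (1 : Site d → Fin d → 𝔸ˣ) x κ ∈ unitaryUnits 𝔸 := fun _ _ => (unitaryUnits 𝔸).one_mem
  obtain ⟨u, hu, huS, h129, hLan, h162, huniq⟩ := H η hη k (cubeFam false L a M ρ k) (hΩ_cubeFam hL1 a M hρL k)
    (cubeLamS L a M ρ k) (cubeLamB L a M ρ k) (hbox_cubeLamB L a M ρ k) (hclass_cubeLamB L a M ρ k) (htower_cubeLam hL1 a M ρ k)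
    (hpart_cubeLam hL1 a M ρ k) SP5base SP5 SH59 SP5u _ _ hα₀' hα₁' hc 1 _ hone hmem h33 h34 hAx h135 h66
  simp only [mgauge_one_left] at hLan h162 huniq
  -- the gauge transformation `v` of p. 98 is unitary ((1.7) on `□̃` alone)
  have hΩ' : ∃ l, l ≤ k ∧ k ≤ l + 1 ∧ ∀ x, InBox (tlo L (tLo a ρ) k) (thi L (tHi a M ρ) k) x → x ∈ Ω l :=
    ⟨k - 1, Nat.sub_le _ _, by omega, fun x hx => hT hx⟩
  have hvG : ∀ x, localGauge L (tLo a ρ) (tHi a M ρ) U₀ k (ctr a M) x ∈ unitaryUnits 𝔸 :=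
    localGauge_mem L hL (avgClosed_unitaryUnits (𝔸 := 𝔸) d L) k U₀ hU₀ hα hα3 hα2 (tLo_le_tHi hM1)
      (pdevOn_lt_of_inAk hL1 hα hA hΩ') (ctr a M)
  refine ⟨u, hu, huS, h129, hLan hk, h162, fun u' hu' hu'S hR' hLan' hA' => huniq u' hu' hu'S hR' hLan' hA' hk,
    fun x => (unitaryUnits 𝔸).mul_mem ((unitaryUnits 𝔸).inv_mem (hvG x)) (hu x), agree135 _ _ U₀ _ u⟩

/-- **PROPOSITION 6 AT THE CUBE MEMBER WITH THE PRINTED SMALLNESS «7dL²Mα₀ ≤ c₁» AND THE PRINTED CONSTANT `7dL²B₁Mα₀`, `B₁ = 5dLB₀`**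
(and the implicit `L ≤ dM`, `B8Prop6OfThm4.smallness_134` ∕ `const_136`): existence of the unitary, `□₀`-supported, restricted `u` with
`U₁ = U₀″^{u⁻¹}` in the Landau gauge of record, `U₁ = e^{iηA}`, `A` Hermitian, `|A_b| ≤ 7dL²B₁Mα₀(Lʲη)⁻¹` on the bonds of the plaquettes
touching `□_j`, and (1.135) on `□̃` — modulo the four sockets at the member. [cite: Balaban1985RegularSpaces, Prop. 6 (1.135)–(1.136) p.99, (1.134) p.99] -/
theorem prop6_exists_cubeMember_printed (hd2 : 2 ≤ d) {L : ℕ} (hL : 2 ≤ L) {B₀ B₀' cu cP : ℝ} (hB₀ : 0 < B₀) (hB₀' : 0 < B₀')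
    (hB : 2 ≤ 5 * (d : ℝ) * L * B₀) (hcu : 0 < cu) (hcP : 0 < cP) :
    ∃ c₁ : ℝ, 0 < c₁ ∧ ∀ (η : ℝ), 0 < η → ∀ (k : ℕ), 1 ≤ k → ∀ (a : Site d) (M ρ : ℕ), L ≤ ρ → ρ ≤ M → 11 * (d : ℝ) < M →
      (L : ℝ) ≤ d * M →
      SockP5base (𝔸 := 𝔸) L B₀ B₀' cP η k (cubeFam false L a M ρ k) (cubeLamS L a M ρ k) →
      SockP5 (𝔸 := 𝔸) L B₀ B₀' cP η k (cubeFam false L a M ρ k) (cubeLamS L a M ρ k) →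
      SockH59 (𝔸 := 𝔸) L B₀ B₀' cP η k (cubeFam false L a M ρ k) (cubeLamS L a M ρ k) (cubeLamB L a M ρ k) →
      SockP5u (𝔸 := 𝔸) L cP cu η k (cubeFam false L a M ρ k) (cubeLamS L a M ρ k) →
      ∀ (U₀ : Site d → Fin d → 𝔸ˣ), (∀ x κ, U₀ x κ ∈ unitaryUnits 𝔸) → ∀ (α₀ : ℝ), 0 < α₀ →
      C0 d * (α₀ * (L : ℝ) ^ 2) ≤ 1 / 3 → 2 * (α₀ * (L : ℝ) ^ 2) ≤ c2' d L →
      ∀ (Ω : ℕ → Set (Site d)), InAk L k η α₀ Ω U₀ → tcube L a M ρ k ⊆ Ω (k - 1) →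
      11 * (d : ℝ) ^ 2 * (L : ℝ) ^ 2 * α₀ + ((M : ℝ) + 4 * ρ) * d * (L : ℝ) ^ 2 * α₀ ≤ 1 / 6 →
      7 * d * (L : ℝ) ^ 2 * M * α₀ ≤ c₁ →
      ∃ u : Site d → 𝔸ˣ, (∀ x, u x ∈ unitaryUnits 𝔸) ∧ (∀ x, x ∉ cubeFam false L a M ρ k 0 → u x = 1) ∧
        Restr129 L k (cubeLamS L a M ρ k k) (1 : Site d → Fin d → 𝔸ˣ) u ∧
        IsLandau138W L k η (cubeFam false L a M ρ k 0) (cubeLamS L a M ρ k k) (1 : Site d → Fin d → 𝔸ˣ)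
          (gaugeAct u⁻¹ (cutFixed L (tLo a ρ) (tHi a M ρ) U₀ k (ctr a M))) ∧
        (∀ j, j ≤ k → ∀ b ∈ {b : Site d × Fin d | SideTouches (cubeFam false L a M ρ k j) b.1 b.2},
          gaugeAct u⁻¹ (cutFixed L (tLo a ρ) (tHi a M ρ) U₀ k (ctr a M)) b.1 b.2 =
              cfgExp η (logCfg η (gaugeAct u⁻¹ (cutFixed L (tLo a ρ) (tHi a M ρ) U₀ k (ctr a M)))) b.1 b.2 ∧
            IsSelfAdjoint (logCfg η (gaugeAct u⁻¹ (cutFixed L (tLo a ρ) (tHi a M ρ) U₀ k (ctr a M))) b.1 b.2) ∧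
            ‖logCfg η (gaugeAct u⁻¹ (cutFixed L (tLo a ρ) (tHi a M ρ) U₀ k (ctr a M))) b.1 b.2‖ ≤
              (7 * d * (L : ℝ) ^ 2 * (5 * (d : ℝ) * L * B₀) * M * α₀) * ((L : ℝ) ^ j * η)⁻¹) ∧
        (∀ u' : Site d → 𝔸ˣ, (∀ x, u' x ∈ unitaryUnits 𝔸) → (∀ x, x ∉ cubeFam false L a M ρ k 0 → u' x = 1) →
          Restr129 L k (cubeLamS L a M ρ k k) (1 : Site d → Fin d → 𝔸ˣ) u' →
          IsLandau138W L k η (cubeFam false L a M ρ k 0) (cubeLamS L a M ρ k k) (1 : Site d → Fin d → 𝔸ˣ)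
            (gaugeAct u'⁻¹ (cutFixed L (tLo a ρ) (tHi a M ρ) U₀ k (ctr a M))) →
          (∃ A' : Site d → Fin d → 𝔸, ∀ j, j ≤ k → ∀ (x : Site d) (κ : Fin d), SideTouches (cubeFam false L a M ρ k j) x κ →
            gaugeAct u'⁻¹ (cutFixed L (tLo a ρ) (tHi a M ρ) U₀ k (ctr a M)) x κ = cfgExp η A' x κ ∧
              ‖A' x κ‖ ≤ (5 * (d : ℝ) * L * B₀ * ((L : ℝ) ^ 3 * α₀ + 6 * d * (L : ℝ) ^ 2 * M * α₀)) * ((L : ℝ) ^ j * η)⁻¹) →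
          u' = u) ∧
        (∀ x, ((localGauge L (tLo a ρ) (tHi a M ρ) U₀ k (ctr a M))⁻¹ * u) x ∈ unitaryUnits 𝔸) ∧
        AgreeOn (tlo L (tLo a ρ) k) (thi L (tHi a M ρ) k)
          (gaugeAct ((localGauge L (tLo a ρ) (tHi a M ρ) U₀ k (ctr a M))⁻¹ * u)⁻¹ U₀)
          (gaugeAct u⁻¹ (cutFixed L (tLo a ρ) (tHi a M ρ) U₀ k (ctr a M))) := by
  obtain ⟨c₁, hc₁, H⟩ := prop6_exists_cubeMember (𝔸 := 𝔸) hd2 hL hB₀ hB₀' hB hcu hcP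
  refine ⟨c₁, hc₁, ?_⟩
  intro η hη k hk a M ρ hρL hρM hM hLdM SP5base SP5 SH59 SP5u U₀ hU₀ α₀ hα hα3 hα2 Ω hA hT hsmall hc
  have hLpos : (0 : ℝ) < L := by exact_mod_cast lt_of_lt_of_le (by norm_num) hL
  have hB₁ : 0 ≤ 5 * (d : ℝ) * L * B₀ := by positivity
  obtain ⟨u, hu, huS, h129, hLan, h162, huniq, hw, h135⟩ := H η hη k hk a M ρ hρL hρM hM SP5base SP5 SH59 SP5u U₀ hU₀ α₀ hα
    hα3 hα2 Ω hA hT hsmall (smallness_134 hLpos hα hLdM hc)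
  refine ⟨u, hu, huS, h129, hLan, fun j hj b hb => ?_, fun u' hu' hu'S hR' hLan' hA' => ?_, hw, h135⟩
  · obtain ⟨h1, h2, h3⟩ := h162 j hj b hb
    refine ⟨h1, h2, h3.trans ?_⟩
    have hη0 : 0 ≤ ((L : ℝ) ^ j * η)⁻¹ := by positivity
    exact mul_le_mul_of_nonneg_right (const_136 hLpos hα hB₁ hLdM) hη0
  · exact huniq u' hu' hu'S hR' hLan' hA'

/-! ## §4 (v1.1) The fixed-point currency of the knit, and print's hypotheses exactly -/

/-- **The regime conditions of (1.130) FROM PRINT'S SMALLNESS** (bookkeeping): if `7dL²Mα₀ ≤ c₁` with `c₁ ≤ 7∕(3C0(d))`, `c₁ ≤ 7c₂′(d, L)∕2`,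
`c₁ ≤ 7∕36`, and `1 ≤ M`, `ρ ≤ M`, `11d < M`, `1 ≤ d`, then `C0·(α₀L²) ≤ 1∕3`, `2(α₀L²) ≤ c₂′` and `11d²L²α₀ + (M + 4ρ)dL²α₀ ≤ 1∕6` (the
hypotheses `hα3`∕`hα2`∕`hsmall` of `B8Eq131Cubes.ineq132_cubes`). [cite: Balaban1985RegularSpaces, (1.130) p.98, Prop. 6 p.99 («let 7dL²Mα₀ ≤ c₁»)] -/
theorem regime_of_printed_smallness {L M ρ : ℕ} (hd : 1 ≤ d) (hM1 : 1 ≤ M) (hρM : ρ ≤ M) (hM : 11 * (d : ℝ) < M)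
    {α₀ c₁ : ℝ} (hα : 0 < α₀) (hc : 7 * d * (L : ℝ) ^ 2 * M * α₀ ≤ c₁) (hc1 : c₁ ≤ 7 / (3 * C0 d))
    (hc2 : c₁ ≤ 7 * c2' d L / 2) (hc3 : c₁ ≤ 7 / 36) :
    C0 d * (α₀ * (L : ℝ) ^ 2) ≤ 1 / 3 ∧ 2 * (α₀ * (L : ℝ) ^ 2) ≤ c2' d L ∧
      11 * (d : ℝ) ^ 2 * (L : ℝ) ^ 2 * α₀ + ((M : ℝ) + 4 * ρ) * d * (L : ℝ) ^ 2 * α₀ ≤ 1 / 6 := by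
  have hd' : (1 : ℝ) ≤ d := by exact_mod_cast hd
  have hM' : (1 : ℝ) ≤ M := by exact_mod_cast hM1
  have hρM' : (ρ : ℝ) ≤ M := by exact_mod_cast hρM
  have hC0 := C0_pos d
  have hx0 : 0 ≤ α₀ * (L : ℝ) ^ 2 := by positivity
  have hT0 : 0 ≤ (d : ℝ) * ((L : ℝ) ^ 2 * α₀) := by positivity
  -- the unit `t := dL²Mα₀ = (7dL²Mα₀)/7 ≤ c₁/7`
  have ht : (d : ℝ) * (L : ℝ) ^ 2 * M * α₀ ≤ c₁ / 7 := by linarith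
  -- `α₀L² ≤ dML²α₀` since `dM ≥ 1`
  have hx : α₀ * (L : ℝ) ^ 2 ≤ c₁ / 7 := by
    have hdM : (1 : ℝ) ≤ (d : ℝ) * M := by nlinarith
    have h1 : 1 * (α₀ * (L : ℝ) ^ 2) ≤ ((d : ℝ) * M) * (α₀ * (L : ℝ) ^ 2) := mul_le_mul_of_nonneg_right hdM hx0
    have h2 : ((d : ℝ) * M) * (α₀ * (L : ℝ) ^ 2) = (d : ℝ) * (L : ℝ) ^ 2 * M * α₀ := by ring
    linarith
  refine ⟨?_, by linarith, ?_⟩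
  · calc C0 d * (α₀ * (L : ℝ) ^ 2) ≤ C0 d * (c₁ / 7) := mul_le_mul_of_nonneg_left hx hC0.le
      _ ≤ C0 d * (7 / (3 * C0 d) / 7) := by gcongr
      _ = 1 / 3 := by field_simp
  · -- `11d²L²α₀ ≤ dML²α₀` from `11d < M`; `(M + 4ρ)dL²α₀ ≤ 5·dML²α₀` from `ρ ≤ M`
    have h11 : 11 * (d : ℝ) ^ 2 * (L : ℝ) ^ 2 * α₀ ≤ (d : ℝ) * (L : ℝ) ^ 2 * M * α₀ := by
      have h' : (11 * (d : ℝ)) * ((d : ℝ) * ((L : ℝ) ^ 2 * α₀)) ≤ (M : ℝ) * ((d : ℝ) * ((L : ℝ) ^ 2 * α₀)) :=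
        mul_le_mul_of_nonneg_right hM.le hT0
      have e1 : 11 * (d : ℝ) ^ 2 * (L : ℝ) ^ 2 * α₀ = (11 * (d : ℝ)) * ((d : ℝ) * ((L : ℝ) ^ 2 * α₀)) := by ring
      have e2 : (d : ℝ) * (L : ℝ) ^ 2 * M * α₀ = (M : ℝ) * ((d : ℝ) * ((L : ℝ) ^ 2 * α₀)) := by ring
      rw [e1, e2]; exact h'
    have h5 : ((M : ℝ) + 4 * ρ) * d * (L : ℝ) ^ 2 * α₀ ≤ 5 * ((d : ℝ) * (L : ℝ) ^ 2 * M * α₀) := by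
      have h54 : ((M : ℝ) + 4 * ρ) ≤ 5 * M := by linarith
      have h' : ((M : ℝ) + 4 * ρ) * ((d : ℝ) * ((L : ℝ) ^ 2 * α₀)) ≤ (5 * M) * ((d : ℝ) * ((L : ℝ) ^ 2 * α₀)) :=
        mul_le_mul_of_nonneg_right h54 hT0
      have e1 : ((M : ℝ) + 4 * ρ) * d * (L : ℝ) ^ 2 * α₀ = ((M : ℝ) + 4 * ρ) * ((d : ℝ) * ((L : ℝ) ^ 2 * α₀)) := by ring
      have e2 : 5 * ((d : ℝ) * (L : ℝ) ^ 2 * M * α₀) = (5 * M) * ((d : ℝ) * ((L : ℝ) ^ 2 * α₀)) := by ring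
      rw [e1, e2]; exact h'
    linarith

/-- **§3 IN THE KNIT'S FIXED-POINT CURRENCY, FOUR INDEPENDENT THRESHOLDS**: `prop6_exists_cubeMember` with the two Proposition-5 existence
sockets as `B8LeafModelZdOfHFP.SockHFP₀`∕`SockHFP` (the output currency of the contraction `B8Prop5ContractionKLevel` ∕ the assembly
`B8SockHFPAssembly`) and `SockH59`, `SockP5u` at their own thresholds `cF₀, cF, c59, cu′` — reduced to §3 below the `min` of the four and the
window threshold of `windows4` (adapters `sockP5base_of_sockHFP₀`, `sockP5_of_sockHFP`, antitonicity), exactly as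
`B8LeafModelZd3.thm4Printed_zd3_of_HFP₄` does for the prototype. [cite: Balaban1985RegularSpaces, Prop. 6 p.99, Prop. 5 (1.106)–(1.109) p.94, (1.59) p.86] -/
theorem prop6_exists_cubeMember_of_HFP₄ (hd2 : 2 ≤ d) {L : ℕ} (hL : 2 ≤ L) {B₀ B₀' cu cF₀ cF c59 cu' : ℝ} (hB₀ : 0 < B₀)
    (hB₀' : 0 < B₀') (hB : 2 ≤ 5 * (d : ℝ) * L * B₀) (hcu : 0 < cu) (hcF₀ : 0 < cF₀) (hcF : 0 < cF) (hc59 : 0 < c59) (hcu' : 0 < cu') :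
    ∃ c₁ : ℝ, 0 < c₁ ∧ ∀ (η : ℝ), 0 < η → ∀ (k : ℕ), 1 ≤ k → ∀ (a : Site d) (M ρ : ℕ), L ≤ ρ → ρ ≤ M → 11 * (d : ℝ) < M →
      SockHFP₀ (𝔸 := 𝔸) L B₀ B₀' cF₀ η k (cubeFam false L a M ρ k) (cubeLamS L a M ρ k) →
      SockHFP (𝔸 := 𝔸) L B₀ B₀' cF η k (cubeFam false L a M ρ k) (cubeLamS L a M ρ k) →
      SockH59 (𝔸 := 𝔸) L B₀ B₀' c59 η k (cubeFam false L a M ρ k) (cubeLamS L a M ρ k) (cubeLamB L a M ρ k) →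
      SockP5u (𝔸 := 𝔸) L cu' cu η k (cubeFam false L a M ρ k) (cubeLamS L a M ρ k) →
      ∀ (U₀ : Site d → Fin d → 𝔸ˣ), (∀ x κ, U₀ x κ ∈ unitaryUnits 𝔸) → ∀ (α₀ : ℝ), 0 < α₀ →
      C0 d * (α₀ * (L : ℝ) ^ 2) ≤ 1 / 3 → 2 * (α₀ * (L : ℝ) ^ 2) ≤ c2' d L →
      ∀ (Ω : ℕ → Set (Site d)), InAk L k η α₀ Ω U₀ → tcube L a M ρ k ⊆ Ω (k - 1) →
      11 * (d : ℝ) ^ 2 * (L : ℝ) ^ 2 * α₀ + ((M : ℝ) + 4 * ρ) * d * (L : ℝ) ^ 2 * α₀ ≤ 1 / 6 →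
      (L : ℝ) ^ 3 * α₀ + 6 * d * (L : ℝ) ^ 2 * M * α₀ ≤ c₁ →
      ∃ u : Site d → 𝔸ˣ, (∀ x, u x ∈ unitaryUnits 𝔸) ∧ (∀ x, x ∉ cubeFam false L a M ρ k 0 → u x = 1) ∧
        Restr129 L k (cubeLamS L a M ρ k k) (1 : Site d → Fin d → 𝔸ˣ) u ∧
        IsLandau138W L k η (cubeFam false L a M ρ k 0) (cubeLamS L a M ρ k k) (1 : Site d → Fin d → 𝔸ˣ)
          (gaugeAct u⁻¹ (cutFixed L (tLo a ρ) (tHi a M ρ) U₀ k (ctr a M))) ∧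
        (∀ j, j ≤ k → ∀ b ∈ {b : Site d × Fin d | SideTouches (cubeFam false L a M ρ k j) b.1 b.2},
          gaugeAct u⁻¹ (cutFixed L (tLo a ρ) (tHi a M ρ) U₀ k (ctr a M)) b.1 b.2 =
              cfgExp η (logCfg η (gaugeAct u⁻¹ (cutFixed L (tLo a ρ) (tHi a M ρ) U₀ k (ctr a M)))) b.1 b.2 ∧
            IsSelfAdjoint (logCfg η (gaugeAct u⁻¹ (cutFixed L (tLo a ρ) (tHi a M ρ) U₀ k (ctr a M))) b.1 b.2) ∧
            ‖logCfg η (gaugeAct u⁻¹ (cutFixed L (tLo a ρ) (tHi a M ρ) U₀ k (ctr a M))) b.1 b.2‖ ≤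
              (5 * (d : ℝ) * L * B₀ * ((L : ℝ) ^ 3 * α₀ + 6 * d * (L : ℝ) ^ 2 * M * α₀)) * ((L : ℝ) ^ j * η)⁻¹) ∧
        (∀ u' : Site d → 𝔸ˣ, (∀ x, u' x ∈ unitaryUnits 𝔸) → (∀ x, x ∉ cubeFam false L a M ρ k 0 → u' x = 1) →
          Restr129 L k (cubeLamS L a M ρ k k) (1 : Site d → Fin d → 𝔸ˣ) u' →
          IsLandau138W L k η (cubeFam false L a M ρ k 0) (cubeLamS L a M ρ k k) (1 : Site d → Fin d → 𝔸ˣ)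
            (gaugeAct u'⁻¹ (cutFixed L (tLo a ρ) (tHi a M ρ) U₀ k (ctr a M))) →
          (∃ A' : Site d → Fin d → 𝔸, ∀ j, j ≤ k → ∀ (x : Site d) (κ : Fin d), SideTouches (cubeFam false L a M ρ k j) x κ →
            gaugeAct u'⁻¹ (cutFixed L (tLo a ρ) (tHi a M ρ) U₀ k (ctr a M)) x κ = cfgExp η A' x κ ∧
              ‖A' x κ‖ ≤ (5 * (d : ℝ) * L * B₀ * ((L : ℝ) ^ 3 * α₀ + 6 * d * (L : ℝ) ^ 2 * M * α₀)) * ((L : ℝ) ^ j * η)⁻¹) →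
          u' = u) ∧
        (∀ x, ((localGauge L (tLo a ρ) (tHi a M ρ) U₀ k (ctr a M))⁻¹ * u) x ∈ unitaryUnits 𝔸) ∧
        AgreeOn (tlo L (tLo a ρ) k) (thi L (tHi a M ρ) k)
          (gaugeAct ((localGauge L (tLo a ρ) (tHi a M ρ) U₀ k (ctr a M))⁻¹ * u)⁻¹ U₀)
          (gaugeAct u⁻¹ (cutFixed L (tLo a ρ) (tHi a M ρ) U₀ k (ctr a M))) := by
  have hL1 : 1 ≤ L := le_trans (by norm_num) hL
  have hd1 : 1 ≤ d := le_trans (by norm_num) hd2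
  -- common provider threshold and the window threshold of the socket adapters
  set cP : ℝ := min (min cF₀ cF) (min c59 cu') with hcPdef
  have hcP : 0 < cP := lt_min (lt_min hcF₀ hcF) (lt_min hc59 hcu')
  have h₁ : cP ≤ cF₀ := (min_le_left _ _).trans (min_le_left _ _)
  have h₂ : cP ≤ cF := (min_le_left _ _).trans (min_le_right _ _)
  have h₃ : cP ≤ c59 := (min_le_right _ _).trans (min_le_left _ _)
  have h₄ : cP ≤ cu' := (min_le_right _ _).trans (min_le_right _ _)
  obtain ⟨cw, hcw, hwin⟩ := windows4 hd1 hL1 hB₀ hB₀' hB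
  have hm₁ : min cP cw ≤ cP := min_le_left _ _
  have hwin' : ∀ α₀ α₁ : ℝ, 0 < α₀ → 0 < α₁ → α₀ + α₁ ≤ min cP cw →
      8 * B₀' * (5 * (d : ℝ) * L * B₀) * (α₀ + α₁) ≤ 1 / 84 ∧ L * (5 * (d : ℝ) * L * B₀ * (α₀ + α₁)) ≤ 1 / 12 ∧
        α₁ ≤ 1 / 4 ∧ 2 * α₁ ≤ 5 * (d : ℝ) * L * B₀ * (α₀ + α₁) :=
    fun α₀ α₁ hα₀ hα₁ hs => hwin α₀ α₁ hα₀ hα₁ (hs.trans (min_le_right _ _))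
  obtain ⟨c₁, hc₁, H⟩ := prop6_exists_cubeMember (𝔸 := 𝔸) hd2 hL hB₀ hB₀' hB hcu (lt_min hcP hcw)
  refine ⟨c₁, hc₁, ?_⟩
  intro η hη k hk a M ρ hρL hρM hM SHFP₀ SHFP SH59 SP5u
  exact H η hη k hk a M ρ hρL hρM hM
    (sockP5base_of_sockHFP₀ hd2 hη hL1 hB₀.le hm₁ hwin' (sockHFP₀_anti h₁ SHFP₀))
    (sockP5_of_sockHFP hd2 hη hL1 hB₀.le hm₁ hwin' (sockHFP_anti h₂ SHFP))
    (sockH59_anti (hm₁.trans h₃) SH59) (sockP5u_anti (hm₁.trans h₄) SP5u)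

/-- **PROPOSITION 6 (p. 99) AT THE CONCRETE CUBE MEMBER WITH EXACTLY PRINT'S HYPOTHESES, modulo the four sockets in the knit's currency**:
«Let U₀, U₀′, □, □̃ be as described above, and let 7dL²Mα₀ ≤ c₁» — i.e. `U₀` unitary-valued in `𝔄_k({Ω_j}, α₀)` (p. 98), `□̃ ⊂ Ω_{k−1}`
(p. 98; `k ≥ 1`), the cube `□^{(k)} = [a, a + M)ᵈ` with `L ≤ R₁M₁ = ρ ≤ M`, print's implicit `L ≤ dM` and the (1.130)-step condition `11d < M`
(G-B8-14) — THEN «there exists a gauge transformation u defined on □̃» (unitary, `= 1` off `□₀`, (1.29) at the member) «such that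
U₀^{u⁻¹} = U₁ = e^{iηA} on □̃, (1.135)» (`AgreeOn` clause with `w = v⁻¹u`) with `A` Hermitian, `Lʲη|A| ≤ 7dL²B₁Mα₀` on the bonds of the
plaquettes touching `□_j` ((1.136), `|A|` member; `B₁ = 5dLB₀`), in the Landau gauge of record ((1.138)), unique in the class.  ONE threshold
`c₁(d, L, B₀, B₀′, cu, cF₀, cF, c59, cu′) > 0`; the tree's (1.130)-regime conditions are absorbed into it (`regime_of_printed_smallness`).
[cite: Balaban1985RegularSpaces, Prop. 6 (1.135)–(1.138) p.99, p.98, (1.134) p.99] -/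
theorem prop6_asPrinted_cubeMember_of_HFP₄ (hd2 : 2 ≤ d) {L : ℕ} (hL : 2 ≤ L) {B₀ B₀' cu cF₀ cF c59 cu' : ℝ} (hB₀ : 0 < B₀)
    (hB₀' : 0 < B₀') (hB : 2 ≤ 5 * (d : ℝ) * L * B₀) (hcu : 0 < cu) (hcF₀ : 0 < cF₀) (hcF : 0 < cF) (hc59 : 0 < c59) (hcu' : 0 < cu') :
    ∃ c₁ : ℝ, 0 < c₁ ∧ ∀ (η : ℝ), 0 < η → ∀ (k : ℕ), 1 ≤ k → ∀ (a : Site d) (M ρ : ℕ), L ≤ ρ → ρ ≤ M → 11 * (d : ℝ) < M →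
      (L : ℝ) ≤ d * M →
      SockHFP₀ (𝔸 := 𝔸) L B₀ B₀' cF₀ η k (cubeFam false L a M ρ k) (cubeLamS L a M ρ k) →
      SockHFP (𝔸 := 𝔸) L B₀ B₀' cF η k (cubeFam false L a M ρ k) (cubeLamS L a M ρ k) →
      SockH59 (𝔸 := 𝔸) L B₀ B₀' c59 η k (cubeFam false L a M ρ k) (cubeLamS L a M ρ k) (cubeLamB L a M ρ k) →
      SockP5u (𝔸 := 𝔸) L cu' cu η k (cubeFam false L a M ρ k) (cubeLamS L a M ρ k) →
      ∀ (U₀ : Site d → Fin d → 𝔸ˣ), (∀ x κ, U₀ x κ ∈ unitaryUnits 𝔸) → ∀ (α₀ : ℝ), 0 < α₀ →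
      ∀ (Ω : ℕ → Set (Site d)), InAk L k η α₀ Ω U₀ → tcube L a M ρ k ⊆ Ω (k - 1) →
      7 * d * (L : ℝ) ^ 2 * M * α₀ ≤ c₁ →
      ∃ u : Site d → 𝔸ˣ, (∀ x, u x ∈ unitaryUnits 𝔸) ∧ (∀ x, x ∉ cubeFam false L a M ρ k 0 → u x = 1) ∧
        Restr129 L k (cubeLamS L a M ρ k k) (1 : Site d → Fin d → 𝔸ˣ) u ∧
        IsLandau138W L k η (cubeFam false L a M ρ k 0) (cubeLamS L a M ρ k k) (1 : Site d → Fin d → 𝔸ˣ)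
          (gaugeAct u⁻¹ (cutFixed L (tLo a ρ) (tHi a M ρ) U₀ k (ctr a M))) ∧
        (∀ j, j ≤ k → ∀ b ∈ {b : Site d × Fin d | SideTouches (cubeFam false L a M ρ k j) b.1 b.2},
          gaugeAct u⁻¹ (cutFixed L (tLo a ρ) (tHi a M ρ) U₀ k (ctr a M)) b.1 b.2 =
              cfgExp η (logCfg η (gaugeAct u⁻¹ (cutFixed L (tLo a ρ) (tHi a M ρ) U₀ k (ctr a M)))) b.1 b.2 ∧
            IsSelfAdjoint (logCfg η (gaugeAct u⁻¹ (cutFixed L (tLo a ρ) (tHi a M ρ) U₀ k (ctr a M))) b.1 b.2) ∧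
            ‖logCfg η (gaugeAct u⁻¹ (cutFixed L (tLo a ρ) (tHi a M ρ) U₀ k (ctr a M))) b.1 b.2‖ ≤
              (7 * d * (L : ℝ) ^ 2 * (5 * (d : ℝ) * L * B₀) * M * α₀) * ((L : ℝ) ^ j * η)⁻¹) ∧
        (∀ u' : Site d → 𝔸ˣ, (∀ x, u' x ∈ unitaryUnits 𝔸) → (∀ x, x ∉ cubeFam false L a M ρ k 0 → u' x = 1) →
          Restr129 L k (cubeLamS L a M ρ k k) (1 : Site d → Fin d → 𝔸ˣ) u' →
          IsLandau138W L k η (cubeFam false L a M ρ k 0) (cubeLamS L a M ρ k k) (1 : Site d → Fin d → 𝔸ˣ)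
            (gaugeAct u'⁻¹ (cutFixed L (tLo a ρ) (tHi a M ρ) U₀ k (ctr a M))) →
          (∃ A' : Site d → Fin d → 𝔸, ∀ j, j ≤ k → ∀ (x : Site d) (κ : Fin d), SideTouches (cubeFam false L a M ρ k j) x κ →
            gaugeAct u'⁻¹ (cutFixed L (tLo a ρ) (tHi a M ρ) U₀ k (ctr a M)) x κ = cfgExp η A' x κ ∧
              ‖A' x κ‖ ≤ (5 * (d : ℝ) * L * B₀ * ((L : ℝ) ^ 3 * α₀ + 6 * d * (L : ℝ) ^ 2 * M * α₀)) * ((L : ℝ) ^ j * η)⁻¹) →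
          u' = u) ∧
        (∀ x, ((localGauge L (tLo a ρ) (tHi a M ρ) U₀ k (ctr a M))⁻¹ * u) x ∈ unitaryUnits 𝔸) ∧
        AgreeOn (tlo L (tLo a ρ) k) (thi L (tHi a M ρ) k)
          (gaugeAct ((localGauge L (tLo a ρ) (tHi a M ρ) U₀ k (ctr a M))⁻¹ * u)⁻¹ U₀)
          (gaugeAct u⁻¹ (cutFixed L (tLo a ρ) (tHi a M ρ) U₀ k (ctr a M))) := by
  have hL1 : 1 ≤ L := le_trans (by norm_num) hL
  have hd1 : 1 ≤ d := le_trans (by norm_num) hd2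
  have hLpos : (0 : ℝ) < L := by exact_mod_cast lt_of_lt_of_le (by norm_num) hL
  have hC0 := C0_pos d
  have hc2 := c2'_pos d L hL1
  obtain ⟨c₀, hc₀, H⟩ := prop6_exists_cubeMember_of_HFP₄ (𝔸 := 𝔸) hd2 hL hB₀ hB₀' hB hcu hcF₀ hcF hc59 hcu'
  -- the threshold: the driver's, capped so that «7dL²Mα₀ ≤ c₁» also yields the tree's (1.130)-regime conditions
  refine ⟨min c₀ (min (7 / (3 * C0 d)) (min (7 * c2' d L / 2) (7 / 36))), ?_, ?_⟩
  · exact lt_min hc₀ (lt_min (by positivity) (lt_min (by positivity) (by norm_num)))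
  intro η hη k hk a M ρ hρL hρM hM hLdM SHFP₀ SHFP SH59 SP5u U₀ hU₀ α₀ hα Ω hA hT hc
  have hρ : 1 ≤ ρ := hL1.trans hρL
  have hM1 : 1 ≤ M := hρ.trans hρM
  have hc' : 7 * d * (L : ℝ) ^ 2 * M * α₀ ≤ c₀ := hc.trans (min_le_left _ _)
  have hcA : 7 * d * (L : ℝ) ^ 2 * M * α₀ ≤ min (7 / (3 * C0 d)) (min (7 * c2' d L / 2) (7 / 36)) := hc.trans (min_le_right _ _)
  obtain ⟨hα3, hα2, hsmall⟩ := regime_of_printed_smallness (L := L) hd1 hM1 hρM hM hα hcA (min_le_left _ _)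
    ((min_le_right _ _).trans (min_le_left _ _)) ((min_le_right _ _).trans (min_le_right _ _))
  have hB₁ : 0 ≤ 5 * (d : ℝ) * L * B₀ := by positivity
  obtain ⟨u, hu, huS, h129, hLan, h162, huniq, hw, h135⟩ := H η hη k hk a M ρ hρL hρM hM SHFP₀ SHFP SH59 SP5u U₀ hU₀ α₀ hα
    hα3 hα2 Ω hA hT hsmall (smallness_134 hLpos hα hLdM hc')
  refine ⟨u, hu, huS, h129, hLan, fun j hj b hb => ?_, huniq, hw, h135⟩
  obtain ⟨h1, h2, h3⟩ := h162 j hj b hb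
  refine ⟨h1, h2, h3.trans ?_⟩
  have hη0 : 0 ≤ ((L : ℝ) ^ j * η)⁻¹ := by positivity
  exact mul_le_mul_of_nonneg_right (const_136 hLpos hα hB₁ hLdM) hη0

end Prop6

#print axioms prop6_exists_cubeMember
#print axioms prop6_asPrinted_cubeMember_of_HFP₄

end Literature.MathematicalPhysics.QuantumFieldTheory.Balaban1983to89.B8Prop6CubeMember

end
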